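import Summits.FinalStateConjecture.FinalStateConjecture.Theorems.SwallowTheDatumParametricKerrBurialEngine
import Summits.FinalStateConjecture.FinalStateConjecture.Theorems.SwallowTheDatumParametricKerrBurialStubFarGluingOfUnitGluing
import Summits.FinalStateConjecture.FinalStateConjecture.Theorems.SwallowTheDatumParametricKerrBurialStubEndChartDatum
import Literature.Geometry.Lorentzian.InitialDataDilation

/-!
# Line `receding-annulus-universal-collar` — skeleton v7 (lead c2): the crux `SwallowTheDatum.ParametricKerrBurial`
# CLOSED MODULO THE ATOM `G = ∀ η, IsBump η → GluingFamilyFor η` and the registered stubs below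

Lead prover-line-stmt-FinalStateConjecture-10052-c2-0, 2026-08-16.  The crux is reduced in the tree to (A) `stub_farGluing` and
(B) `stub_collarDatum` (`ParametricKerrBurial_of_farGluing_of_collarDatum`, p92199).

* (A) is PROVED here (sorry-free) from the atom `stub_gluingFamily` (Mao–Oh–Tao Thm 1.7 with `C^∞` parameter dependence —
  UNPRINTED, the route's posited upgrade, never literature) and the two explicit stubs `stub_modelData`, `stub_schwOutSite`,
  through the landed chain of lead c1: `stub_endChartDatum` (p99408), `stub_endRescaling_of_chartDatum` (p101083),
  `stub_chargeBound` (p112663), `stub_unitAnnulusGluing_of_gluingFamily` (p115929), `stub_farGluing_of_unitGluing` (p116104).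
* (B) ⟸ `stub_collar_of_plugDataPlus` ∘ `PlugDataPlusAt` ⟸ `stub_plugDataPlusFrom_of` (Mao–Oh–Tao applied `N + 3` times:
  the printed fact `ObstructionFreeAnnularGluing`, itself a COROLLARY of the atom at constant families —
  `obstructionFreeAnnularGluing_of_gluingFamily` below) from `stub_capEnd`, `stub_modelData`, `stub_schwOutSite` and the
  CORRECTED bulk stub `stub_bulkAt` (`∀ M > 0, ∃ μ'₀ > 0, ∀ μ' ≤ μ'₀`; gen-1's `∀ μ' > 0` form is false: the deviation of
  `schwField (μ'/64)` on `A_1` is `≥ μ'/32` while `MOTHyp` forces `sIn₀² < μo εo²`).  The four stubs `stub_capEnd`,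
  `stub_modelData`, `stub_schwOutSite`, `stub_plugDataPlusFrom_of` are registered VERBATIM on the sibling crux 10051 and being
  landed by its lead (same Engine vocabulary); `stub_bulkAt` is this lead's (explicit conformally flat bulk: central puncture +
  `D_N`-symmetric ring; every site an exact weak-field Schwarzschild model up to a `C²`-small perturbation, through the abstract
  site-margin lemma `stub_siteMargin` and the bulk-datum construction `stub_bulkDatum`); `stub_collar_of_plugDataPlus` is the
  composition of `stub_locatedPlug` (10055's landed assembly re-run exporting core agreement and shield location) and
  `stub_collar_of_locatedPlug` (pure pull-back dilation).
* `ParametricKerrBurial_proof` : the crux BY NAME, sorry-free itself; sorries live only in `stub_*`.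

References: Mao–Oh–Tao arXiv:2308.13031 Thm 1.7, Rem 1.9, Rem 1.11; Brill–Lindquist, Phys. Rev. 131 (1963) 471; the crux
directory's `PICKED.md` (c2) and `Lines/receding_annulus_universal_collar.lean` (gen-1 skeleton v6, engine design).
-/

set_option linter.dupNamespace false

noncomputable section

-- instance search through the nested operator types `E3 →L E3 →L ℝ` (norms of `iteratedFDeriv`s in `DevLE`)
set_option maxSynthPendingDepth 3

namespace Summit.FinalStateConjecture.FinalStateConjecture.Theorems.SwallowTheDatum.ParametricKerrBurial

open scoped Manifold ContDiff Topology BigOperators InnerProductSpace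
open Bundle Set Filter Function MeasureTheory Literature.Geometry.Lorentzian
open Literature.Geometry.Lorentzian.MaoOhTao Literature.Geometry.Lorentzian.InitialDataSet


/-! ## §0 (REDUCED CHECK VARIANT ONLY) placeholders for two LANDED theorems whose oleans are unbuilt on the farm right now:
`stub_chargeBound` (p112663, …StubChargeBound.lean) and `stub_unitAnnulusGluing_of_gluingFamily` (p115929,
…StubUnitGluingReduction.lean), signatures verbatim; the full skeleton imports the modules instead. -/

theorem landed_chargeBound :
    ∀ η : ℝ → ℝ, IsBump η → ∃ Cη : ℝ, 0 < Cη ∧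
      ∀ (g k : E3 → E3 →L[ℝ] E3 →L[ℝ] ℝ) (s : ℝ), ContDiff ℝ 1 g → 0 ≤ s → DevLE g k 1 2 s →
        |avgE η 1 g| ≤ Cη * s ∧ (∀ i, |avgP η 1 k i| ≤ Cη * s) ∧
          (∀ i, |avgC η 1 g i| ≤ Cη * s) ∧ (∀ i, |avgJ η 1 k i| ≤ Cη * s) := by
  sorry

theorem landed_unitAnnulusGluing_of_gluingFamily :
    (∀ η : ℝ → ℝ, IsBump η → GluingFamilyFor η) →
    (∀ m : ℝ, 0 < m → ∃ S : InitialDataSet (𝓡 3) E3, SchwDatum m S) →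
    (∀ η : ℝ → ℝ, IsBump η → ∀ (εo μo μ₀ : ℝ), 0 < εo → 0 < μo → 0 < μ₀ →
      ∃ (m sOut θ : ℝ), 0 < m ∧ m ≤ μ₀ ∧ 0 < θ ∧ SchwOutSite η εo μo m sOut θ) →
    (∀ η : ℝ → ℝ, IsBump η → ∃ Cη : ℝ, 0 < Cη ∧
      ∀ (g k : E3 → E3 →L[ℝ] E3 →L[ℝ] ℝ) (s : ℝ), ContDiff ℝ 1 g → 0 ≤ s → DevLE g k 1 2 s →
        |avgE η 1 g| ≤ Cη * s ∧ (∀ i, |avgP η 1 k i| ≤ Cη * s) ∧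
          (∀ i, |avgC η 1 g i| ≤ Cη * s) ∧ (∀ i, |avgJ η 1 k i| ≤ Cη * s)) →
    ∃ (η δ₀ : ℝ), 0 < η ∧ 0 < δ₀ ∧
      ∀ (Rstar : ℝ) (I : ℝ → InitialDataSet (𝓡 3) E3),
        SmoothSectionsOn 𝓘(ℝ, ℝ) I {p : ℝ × E3 | Rstar < p.1 ∧ 1 / 2 < ‖p.2‖} →
        (∀ R : ℝ, Rstar < R → VacuumOn {y | 1 / 2 < ‖y‖} (I R)) →
        (∀ R : ℝ, Rstar < R → ∀ y : E3, 1 ≤ ‖y‖ → ‖y‖ ≤ 4 →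
          (∀ i ≤ 2, ‖iteratedFDeriv ℝ i
              (fun z : E3 ↦ (I R).coordH z - (innerSL ℝ : E3 →L[ℝ] E3 →L[ℝ] ℝ)) y‖ ≤ δ₀) ∧
          (∀ i ≤ 1, ‖iteratedFDeriv ℝ i (I R).coordK y‖ ≤ δ₀)) →
        ∃ O : ℝ → InitialDataSet (𝓡 3) E3,
          SmoothSectionsOn 𝓘(ℝ, ℝ) O {p : ℝ × E3 | Rstar < p.1 ∧ 1 < ‖p.2‖} ∧
          ∀ R : ℝ, Rstar < R →
            VacuumOn {y | 1 < ‖y‖} (O R) ∧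
            (∀ y : E3, 1 < ‖y‖ → ‖y‖ < 2 → (O R).h.inner y = (I R).h.inner y ∧ (O R).k y = (I R).k y) ∧
            IsIsotropicBeyond η 32 (O R) := by
  sorry

/-! ## §1 The atom -/

/-- **STUB (ATOM) `stub_gluingFamily`** — Mao–Oh–Tao Thm 1.7 / Rem 1.9 with `C^∞` dependence on a real parameter of the
in-data (UNPRINTED; the one posited ingredient of the whole line; registered by lead c1, promote-stub candidate). [folklore] -/
theorem stub_gluingFamily : ∀ η : ℝ → ℝ, IsBump η → GluingFamilyFor η := by
  sorry

/-! ## §2 Stubs shared verbatim with the sibling crux 10051 (being landed by its lead in the same Engine vocabulary) -/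

/-- **STUB S2 `stub_capEnd`** (capping the end through the sheet-2 inversion chart; registered on 10052 by gen-1 and on 10051
by its lead c2, same signature). [folklore] -/
theorem stub_capEnd : ∀ (M ρ₃ X₃ : ℝ), 0 < M → 0 < ρ₃ → 0 < X₃ → X₃ * ρ₃ = (M / 2) ^ 2 →
    ∀ G : InitialDataSet (𝓡 3) E3, CapEndAt M ρ₃ X₃ G := by
  sorry

/-- **STUB S3a `stub_modelData`**: the flat vacuum datum and the smoothed Schwarzschild(`m`) puncture exist (registered on 10051,
same signature = conjuncts 1–2 of gen-1's `stub_explicit`). [folklore] -/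
theorem stub_modelData :
    (∃ F : InitialDataSet (𝓡 3) E3, FlatVacuumDatum F) ∧
    (∀ m : ℝ, 0 < m → ∃ S : InitialDataSet (𝓡 3) E3, SchwDatum m S) := by
  sorry

/-- **STUB S3b `stub_schwOutSite`**: the exact Schwarzschild far field is a Thm-1.7 OUT-site against every nearly flat core
(registered on 10051, same signature = conjunct 3 of gen-1's `stub_explicit`). [folklore] -/
theorem stub_schwOutSite : ∀ η : ℝ → ℝ, IsBump η → ∀ (εo μo μ₀ : ℝ), 0 < εo → 0 < μo → 0 < μ₀ →
    ∃ (m sOut θ : ℝ), 0 < m ∧ m ≤ μ₀ ∧ 0 < θ ∧ SchwOutSite η εo μo m sOut θ := by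
  sorry

/-- **STUB S4 `stub_plugDataPlusFrom_of`**: PlugData⁺ with the mass `M` EXPORTED, from the printed gluing fact, the cap, the
model data, the Schwarzschild out-site and the CORRECTED bulk (registered on 10051 by its lead c2, p116642 pending).
[folklore] -/
theorem stub_plugDataPlusFrom_of : ObstructionFreeAnnularGluing →
    (∀ (M ρ₃ X₃ : ℝ), 0 < M → 0 < ρ₃ → 0 < X₃ → X₃ * ρ₃ = (M / 2) ^ 2 →
      ∀ G : InitialDataSet (𝓡 3) E3, CapEndAt M ρ₃ X₃ G) →
    (∃ F : InitialDataSet (𝓡 3) E3, FlatVacuumDatum F) →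
    (∀ m : ℝ, 0 < m → ∃ S : InitialDataSet (𝓡 3) E3, SchwDatum m S) →
    (∀ η : ℝ → ℝ, IsBump η → ∀ (εo μo μ₀ : ℝ), 0 < εo → 0 < μo → 0 < μ₀ →
      ∃ (m sOut θ : ℝ), 0 < m ∧ m ≤ μ₀ ∧ 0 < θ ∧ SchwOutSite η εo μo m sOut θ) →
    (∀ η : ℝ → ℝ, IsBump η → ∀ (εo μo M : ℝ), 0 < εo → 0 < μo → 0 < M →
      ∃ μ'₀ : ℝ, 0 < μ'₀ ∧ ∀ μ' : ℝ, 0 < μ' → μ' ≤ μ'₀ → BulkAt η εo μo M μ') →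
    ∀ μ₀ : ℝ, 0 < μ₀ → ∀ M : ℝ, 0 < M →
      ∃ (μ ρ₃ lam : ℝ) (D₀ : InitialDataSet (𝓡 3) E3),
        0 < μ ∧ μ ≤ μ₀ ∧ 0 < ρ₃ ∧ ρ₃ < M / 40 ∧ 0 < lam ∧ 2 * lam < ρ₃ ∧
        (∀ [D₀.metric.HasLeviCivita], D₀.IsVacuumConstraintSolution) ∧
        (∀ y : E3, ρ₃ < ‖y‖ →
          (∀ v w : E3, D₀.h.inner y v w = Schwarzschild.conformalFactor M y ^ 4 * ⟪v, w⟫_ℝ) ∧ D₀.k y = 0) ∧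
        (∀ y : E3, lam < ‖y‖ → ‖y‖ < 2 * lam →
          (∀ v w : E3, D₀.h.inner y v w = (lam ^ 2)⁻¹ * (1 + lam * μ / (2 * ‖y‖)) ^ 4 * ⟪v, w⟫_ℝ) ∧
            D₀.k y = 0) := by
  sorry

/-! ## §3 This lead's stubs: the bulk (site margin, bulk datum, the corrected `BulkAt`) and the collar plumbing -/

/-- **STUB BK1 `stub_siteMargin`** (the abstract site lemma): for the bump `η` and thresholds `εo, μo` there are a mass ceiling
`m₀`, a relative margin `κ` and a deviation constant `cdev` such that for masses `0 ≤ mIn`, `8 mIn ≤ mOut`, `0 < mOut ≤ m₀` the Thm-1.7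
hypothesis block `MOTHyp` holds for IN = EXACT time-symmetric isotropic Schwarzschild(`mIn`) `schwField mIn` (flat for `mIn = 0`)
with deviation bound `cdev·mIn`, against ANY time-symmetric OUT metric field which is `κ·mOut`-close in `C²` on the closed
annulus `[32, 64]` to `schwField mOut` (exact charges `E ≈ 8πm`, `P = C = J = 0`, Lipschitz dependence of the η-averaged
charges and of `DevLE` on the fields — `stub_chargeBound` —, smallness of `m₀` after `εo, μo`). [folklore] -/
theorem stub_siteMargin : ∀ η : ℝ → ℝ, IsBump η → ∀ (εo μo : ℝ), 0 < εo → 0 < μo →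
    ∃ (m₀ κ cdev : ℝ), 0 < m₀ ∧ 0 < κ ∧ 0 ≤ cdev ∧
      ∀ (mIn mOut : ℝ), 0 ≤ mIn → 8 * mIn ≤ mOut → 0 < mOut → mOut ≤ m₀ →
        DevLE (schwField mIn) zeroField 1 2 (cdev * mIn) ∧
        ∃ sOut : ℝ, ∀ gOut : E3 → E3 →L[ℝ] E3 →L[ℝ] ℝ,
          ContDiffOn ℝ ∞ gOut {x : E3 | 16 < ‖x‖} →
          DevLE (fun x ↦ gOut x - schwField mOut x + (innerSL ℝ : E3 →L[ℝ] E3 →L[ℝ] ℝ)) zeroField 32 64 (κ * mOut) →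
          MOTHyp η εo μo (schwField mIn) zeroField gOut zeroField (cdev * mIn) sOut := by
  sorry

/-- **STUB BK2 `stub_bulkDatum`** (the conformally flat multi-puncture datum): for a level `A > 0`, punctures `c_j` with weights
`α_j > 0` and smoothing radii `s_j > 0` there is a smooth time-symmetric datum `B` on `ℝ³` whose metric IS
`(A + Σ_j α_j/‖y − c_j‖)⁴ δ` off the balls `B(c_j, s_j/2)` and which is vacuum there (harmonicity of `1/‖y − c‖`, the conformal
scalar-curvature formula `R(ψ⁴δ) = −8ψ⁻⁵Δψ`, `k = 0`; the punctures smoothed positively inside the half-balls). Brill–Lindquist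
1963. [folklore] -/
theorem stub_bulkDatum : ∀ (A : ℝ) (N : ℕ) (c : Fin (N + 1) → E3) (α s : Fin (N + 1) → ℝ),
    0 < A → (∀ j, 0 < α j) → (∀ j, 0 < s j) →
    ∃ B : InitialDataSet (𝓡 3) E3, (∀ y : E3, B.k y = 0) ∧
      ∀ y : E3, (∀ j, s j / 2 < ‖y - c j‖) →
        B.coordH y = (A + ∑ j, α j / ‖y - c j‖) ^ 4 • (innerSL ℝ : E3 →L[ℝ] E3 →L[ℝ] ℝ) ∧ VacAt B y := by
  sorry

/-! ## §3b Bricks of the bulk (wave 2): ring geometry, Coulomb Taylor bounds, fourth-power perturbation, inversion -/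

/-- **STUB BK3a `stub_bulkRing`** (geometry of the regular `N`-gon of puncture directions): unit norms, `N`-periodicity,
pairwise distance `≥ 4/N` (Jordan's inequality), `D_N`-symmetry of the Coulomb sums `Σ_{k≠j} ‖ĉ_j − ĉ_k‖⁻ᵖ` (`p = 1, 2, 3`),
and their orders `T_N ≍ N log N`, `U_N ≲ N²`, `V_N ≲ N³`. [folklore] -/
theorem stub_bulkRing : ∀ (N : ℕ) (c : ℕ → E3), 3 ≤ N →
    (∀ k : ℕ, c k = Real.cos (2 * Real.pi * k / N) • e 0 + Real.sin (2 * Real.pi * k / N) • e 1) →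
    (∀ k : ℕ, ‖c k‖ = 1) ∧ (∀ k : ℕ, c (k + N) = c k) ∧
    (∀ j k : ℕ, j < k → k < j + N → (4 : ℝ) / N ≤ ‖c j - c k‖) ∧
    (∀ j ∈ Finset.Icc 1 N,
      ∑ k ∈ (Finset.Icc 1 N).erase j, ‖c j - c k‖⁻¹ = ∑ k ∈ Finset.Ico 1 N, ‖c 0 - c k‖⁻¹) ∧
    (∀ j ∈ Finset.Icc 1 N,
      ∑ k ∈ (Finset.Icc 1 N).erase j, (‖c j - c k‖ ^ 2)⁻¹ = ∑ k ∈ Finset.Ico 1 N, (‖c 0 - c k‖ ^ 2)⁻¹) ∧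
    (∀ j ∈ Finset.Icc 1 N,
      ∑ k ∈ (Finset.Icc 1 N).erase j, (‖c j - c k‖ ^ 3)⁻¹ = ∑ k ∈ Finset.Ico 1 N, (‖c 0 - c k‖ ^ 3)⁻¹) ∧
    (N / (2 * Real.pi) * Real.log (N / 2) ≤ ∑ k ∈ Finset.Ico 1 N, ‖c 0 - c k‖⁻¹) ∧
    (∑ k ∈ Finset.Ico 1 N, ‖c 0 - c k‖⁻¹ ≤ N * (1 + Real.log N)) ∧
    (∑ k ∈ Finset.Ico 1 N, (‖c 0 - c k‖ ^ 2)⁻¹ ≤ (N : ℝ) ^ 2) ∧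
    (∑ k ∈ Finset.Ico 1 N, (‖c 0 - c k‖ ^ 3)⁻¹ ≤ (N : ℝ) ^ 3) := by
  sorry

/-- **STUB BK3b `stub_bulkCoulomb`** (the Newton kernel and the evaluation-shift Taylor bound): (i) `‖Dᵐ(‖·‖⁻¹)(u)‖ ≤ C/‖u‖ᵐ⁺¹`
for `m ≤ 3` (homogeneity of degree `−1` and compactness of the unit sphere); (ii) for finitely many sources `p_i` at
distance `≥ d_i` with weights `wgt_i ≥ 0`, the potential `G(w) = Σ wgt_i/‖p_i + w‖` on `‖w‖ ≤ d_i/2` satisfies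
`|G(w) − G(0)| ≤ C‖w‖ Σ wgt_i/d_i²` and `‖DᵐG(w)‖ ≤ C Σ wgt_i/d_iᵐ⁺¹` (`m = 1, 2`). [folklore] -/
theorem stub_bulkCoulomb :
    (∃ C : ℝ, 0 < C ∧ ∀ u : E3, u ≠ 0 → ∀ m : ℕ, m ≤ 3 →
      ‖iteratedFDeriv ℝ m (fun v : E3 ↦ ‖v‖⁻¹) u‖ ≤ C / ‖u‖ ^ (m + 1)) ∧
    (∃ C : ℝ, 0 < C ∧ ∀ (S : Finset ℕ) (p : ℕ → E3) (wgt d : ℕ → ℝ),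
      (∀ i ∈ S, 0 ≤ wgt i) → (∀ i ∈ S, 0 < d i ∧ d i ≤ ‖p i‖) →
      ∀ w : E3, (∀ i ∈ S, ‖w‖ ≤ d i / 2) →
        |∑ i ∈ S, wgt i * ‖p i + w‖⁻¹ - ∑ i ∈ S, wgt i * ‖p i‖⁻¹| ≤ C * ‖w‖ * ∑ i ∈ S, wgt i / d i ^ 2 ∧
        (∀ m : ℕ, 1 ≤ m → m ≤ 2 →
          ‖iteratedFDeriv ℝ m (fun w : E3 ↦ ∑ i ∈ S, wgt i * ‖p i + w‖⁻¹) w‖ ≤ C * ∑ i ∈ S, wgt i / d i ^ (m + 1)) ∧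
        ContDiffAt ℝ ∞ (fun w : E3 ↦ ∑ i ∈ S, wgt i * ‖p i + w‖⁻¹) w) := by
  sorry

/-- **STUB BK3c `stub_bulkCoulombSource`** (the source-shift Taylor bound, from the Newton-kernel bounds): moving finitely
many unit sources from the origin to points `q_i` with `‖q_i‖ ≤ ℓ ≤ ‖z‖/4` changes the potential at `z`, together with its
first two derivatives, by at most `C · #S · ℓ/‖z‖ᵐ⁺²`. [folklore] -/
theorem stub_bulkCoulombSource :
    (∃ C : ℝ, 0 < C ∧ ∀ u : E3, u ≠ 0 → ∀ m : ℕ, m ≤ 3 →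
      ‖iteratedFDeriv ℝ m (fun v : E3 ↦ ‖v‖⁻¹) u‖ ≤ C / ‖u‖ ^ (m + 1)) →
    ∃ C : ℝ, 0 < C ∧ ∀ (S : Finset ℕ) (q : ℕ → E3) (ℓ : ℝ) (z : E3), 0 ≤ ℓ → (∀ i ∈ S, ‖q i‖ ≤ ℓ) →
      0 < ‖z‖ → 4 * ℓ ≤ ‖z‖ →
      (∀ m : ℕ, m ≤ 2 →
        ‖iteratedFDeriv ℝ m (fun z : E3 ↦ ∑ i ∈ S, (‖z - q i‖⁻¹ - ‖z‖⁻¹)) z‖ ≤ C * S.card * ℓ / ‖z‖ ^ (m + 2)) ∧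
      ContDiffAt ℝ ∞ (fun z : E3 ↦ ∑ i ∈ S, (‖z - q i‖⁻¹ - ‖z‖⁻¹)) z := by
  sorry

/-- **STUB BK3d `stub_bulkFourthPower`** (perturbing the conformal factor): if `u` has `C²`-size `≤ 2` and `e` has `C²`-size
`≤ ε ≤ 1` at a point of the gluing annulus, then the metric fields `(u + e)⁴ δ` and `u⁴ δ` are `C ε`-close in `C²` there
(Leibniz bounds). [folklore] -/
theorem stub_bulkFourthPower : ∃ C : ℝ, 0 < C ∧ ∀ (u e : E3 → ℝ) (x : E3) (ε : ℝ), 16 < ‖x‖ →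
    ContDiffOn ℝ 2 u {y : E3 | 16 < ‖y‖} → ContDiffOn ℝ 2 e {y : E3 | 16 < ‖y‖} →
    (∀ m : ℕ, m ≤ 2 → ‖iteratedFDeriv ℝ m u x‖ ≤ 2) → 0 ≤ ε → ε ≤ 1 →
    (∀ m : ℕ, m ≤ 2 → ‖iteratedFDeriv ℝ m e x‖ ≤ ε) →
    ∀ m : ℕ, m ≤ 2 →
      ‖iteratedFDeriv ℝ m (fun y : E3 ↦ ((u y + e y) ^ 4 - u y ^ 4) • (innerSL ℝ : E3 →L[ℝ] E3 →L[ℝ] ℝ)) x‖ ≤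
        C * ε := by
  sorry

/-- **STUB BK3e `stub_bulkInversion`** (reading a small field through the sheet-2 inversion): for `Φ` of `C²`-size `≤ ε` on
the shell `1/128 < ‖z‖ < 1/16`, the function `x ↦ ‖x‖⁻¹ Φ(x/‖x‖²)` has `C²`-size `≤ C ε` on the gluing annulus
`32 ≤ ‖x‖ ≤ 64` (chain rule through the fixed smooth inversion `inv 1`). [folklore] -/
theorem stub_bulkInversion : ∃ C : ℝ, 0 < C ∧ ∀ (Φ : E3 → ℝ) (ε : ℝ), 0 ≤ ε →
    ContDiffOn ℝ 2 Φ {z : E3 | 1 / 128 < ‖z‖ ∧ ‖z‖ < 1 / 16} →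
    (∀ z : E3, 1 / 128 < ‖z‖ → ‖z‖ < 1 / 16 → ∀ m : ℕ, m ≤ 2 → ‖iteratedFDeriv ℝ m Φ z‖ ≤ ε) →
    ∀ x : E3, 32 ≤ ‖x‖ → ‖x‖ ≤ 64 →
      (∀ m : ℕ, m ≤ 2 → ‖iteratedFDeriv ℝ m (fun x : E3 ↦ ‖x‖⁻¹ * Φ (inv 1 x)) x‖ ≤ C * ε) ∧
      ContDiffAt ℝ 2 (fun x : E3 ↦ ‖x‖⁻¹ * Φ (inv 1 x)) x := by
  sorry

/-- **STUB BK `stub_bulkAt`** (the CORRECTED bulk statement = hypothesis 6 of `stub_plugDataPlusFrom_of` verbatim; HELD BY THE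
LEAD): for every mass `M > 0` there is a core-mass ceiling `μ'₀` below which the Brill–Lindquist bulk with all its Thm-1.7 sites
exists — central puncture of weight `α₀` (matched to `μ'`) at the origin plus a `D_N`-symmetric ring of `N` punctures of equal
weight `(M/2 − α₀)/N` at radius `L`, level `A = 8`, depth `ρ₃ ≤ m₀ M/32`, `N → ∞` the small parameter (`L ∝ M² log N/(N m₀)`):
ring sites and the central site by `stub_siteMargin` with first-order Taylor remainders of the regular parts, the end site by the
Kelvin identity `invReadH B = (1 + 8M/(2X₃|x|) + O(L/ρ₃))⁴ δ`. [folklore] -/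
theorem stub_bulkAt : ∀ η : ℝ → ℝ, IsBump η → ∀ (εo μo M : ℝ), 0 < εo → 0 < μo → 0 < M →
    ∃ μ'₀ : ℝ, 0 < μ'₀ ∧ ∀ μ' : ℝ, 0 < μ' → μ' ≤ μ'₀ → BulkAt η εo μo M μ' := by
  sorry

/-- **STUB S5a `stub_locatedPlug`** (10055's assembly, re-run with two exports): from PlugData (`D₀` vacuum on `ℝ³`, exactly
time-symmetric isotropic Schwarzschild(`M`) beyond `ρ₃ < M/40`) an ADMISSIBLE datum `D` on `ℝ³` which IS `D₀` on the core ball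
`{‖y‖ < M/32}` and is Kerr-shielded by a chart ranging in `{‖y‖ > M}` (`AssemblyZones.exists_zonesData`, whose glued field is
`D₀` on `{‖y‖ < M/32}` by definition; `stub_assembly` with junction `r₁ = M`, whose shield has range `{M < ‖z‖}`;
admissibility as in `kerrShieldedDataExist_of_plugData`). [folklore] -/
theorem stub_locatedPlug : ∀ [Kerr.Facts] (M ρ₃ : ℝ) (D₀ : InitialDataSet (𝓡 3) E3), 0 < M → 0 < ρ₃ → ρ₃ < M / 40 →
    (∀ [D₀.metric.HasLeviCivita], D₀.IsVacuumConstraintSolution) →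
    (∀ y : E3, ρ₃ < ‖y‖ →
      (∀ v w : E3, D₀.h.inner y v w = Schwarzschild.conformalFactor M y ^ 4 * ⟪v, w⟫_ℝ) ∧ D₀.k y = 0) →
    ∃ D ∈ admissibleVacuumData E3,
      (∀ y : E3, ‖y‖ < M / 32 → D.h.inner y = D₀.h.inner y ∧ D.k y = D₀.k y) ∧ IsKerrShieldedAway M D := by
  sorry

/-- **STUB S5b `stub_collar_of_locatedPlug`** (pure pull-back dilation): from the located plug and PlugData⁺ to the universal
collar — pull the admissible located-shielded datum back along `y ↦ λ y` (`comap_mem_admissibleVacuumData`,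
`isKerrShielded_comap` made located: the chart `λ⁻¹ φ` ranges in `{‖y‖ > M/λ} ⊆ {‖y‖ > 2}`), so that the annulus
`λ⁻²(1 + λμ/2‖y‖)⁴ δ` on `{λ < ‖y‖ < 2λ} ⊆ {‖y‖ < M/32}` becomes `IsSchwarzschildAnnulus · μ`. [folklore] -/
theorem stub_collar_of_locatedPlug :
    (∀ [Kerr.Facts] (M ρ₃ : ℝ) (D₀ : InitialDataSet (𝓡 3) E3), 0 < M → 0 < ρ₃ → ρ₃ < M / 40 →
      (∀ [D₀.metric.HasLeviCivita], D₀.IsVacuumConstraintSolution) →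
      (∀ y : E3, ρ₃ < ‖y‖ →
        (∀ v w : E3, D₀.h.inner y v w = Schwarzschild.conformalFactor M y ^ 4 * ⟪v, w⟫_ℝ) ∧ D₀.k y = 0) →
      ∃ D ∈ admissibleVacuumData E3,
        (∀ y : E3, ‖y‖ < M / 32 → D.h.inner y = D₀.h.inner y ∧ D.k y = D₀.k y) ∧ IsKerrShieldedAway M D) →
    (∀ μ₀ : ℝ, 0 < μ₀ → PlugDataPlusAt μ₀) →
    (∀ [Kerr.Facts], ∀ μ₀ : ℝ, 0 < μ₀ → ∃ μ : ℝ, 0 < μ ∧ μ ≤ μ₀ ∧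
      ∃ C ∈ admissibleVacuumData E3, IsSchwarzschildAnnulus C μ ∧ IsKerrShieldedAway 2 C) := by
  sorry

/-! ## §4 Kernel-checked compositions -/

/-- The coordinate reading `coordH` of a datum on `ℝ³` is `C^∞`. [folklore] -/
theorem contDiff_coordH' (D : InitialDataSet (𝓡 3) E3) : ContDiff ℝ ∞ D.coordH :=
  D.contMDiff_coordH.contDiff

/-- The coordinate reading `coordK` of a datum on `ℝ³` is `C^∞`. [folklore] -/
theorem contDiff_coordK' (D : InitialDataSet (𝓡 3) E3) : ContDiff ℝ ∞ D.coordK :=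
  D.contMDiff_coordK.contDiff

/-- **The printed gluing fact from the atom**: `GluingFamilyFor η` at the CONSTANT family `t ↦ Din` is Thm 1.7 for the pair
`(Din, Dout)`. [cite: MaoOhTao2023, Thm 1.7] -/
theorem obstructionFreeAnnularGluing_of_gluingFamily (hG : ∀ η : ℝ → ℝ, IsBump η → GluingFamilyFor η) :
    ObstructionFreeAnnularGluing := by
  intro η hη
  obtain ⟨εo, μo, hεo, hμo, h⟩ := hG η hη
  refine ⟨εo, μo, hεo, hμo, fun Din Dout sIn sOut hvin hvout hdin hdout h1 h2 h3 h4 h5 ↦ ?_⟩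
  have hH : ContDiffOn ℝ ∞ (fun p : ℝ × E3 ↦ Din.coordH p.2) ({t | (0 : ℝ) < t} ×ˢ univ) :=
    ((contDiff_coordH' Din).comp contDiff_snd).contDiffOn
  have hK : ContDiffOn ℝ ∞ (fun p : ℝ × E3 ↦ Din.coordK p.2) ({t | (0 : ℝ) < t} ×ˢ univ) :=
    ((contDiff_coordK' Din).comp contDiff_snd).contDiffOn
  obtain ⟨D, -, -, hD⟩ := h 0 (fun _ ↦ Din) Dout (fun _ ↦ sIn) sOut hH hK hvout
    (fun t _ ↦ ⟨hvin, hdin, hdout, h1, h2, h3, h4, h5⟩)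
  exact ⟨D 1, hD 1 one_pos⟩

/-- **(A) far gluing from the atom** (c1's chain): the shared stub `stub_farGluing` verbatim. [cite: MaoOhTao2023, Thm 1.7, 1.10] -/
theorem farGluing_of_gluingFamily (hG : ∀ η : ℝ → ℝ, IsBump η → GluingFamilyFor η)
    (hSD : ∀ m : ℝ, 0 < m → ∃ S : InitialDataSet (𝓡 3) E3, SchwDatum m S)
    (hSO : ∀ η : ℝ → ℝ, IsBump η → ∀ (εo μo μ₀ : ℝ), 0 < εo → 0 < μo → 0 < μ₀ →
      ∃ (m sOut θ : ℝ), 0 < m ∧ m ≤ μ₀ ∧ 0 < θ ∧ SchwOutSite η εo μo m sOut θ) :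
    ∀ (X : Type) [TopologicalSpace X] [ChartedSpace E3 X] [IsManifold (𝓡 3) ∞ X] [T2Space X]
      [SecondCountableTopology X] [ConnectedSpace X], ∀ d ∈ admissibleVacuumData X,
      ∃ (η : ℝ) (e : AFEnd X) (Rstar : ℝ) (m : ℝ → ℝ) (G : ℝ → InitialDataSet (𝓡 3) X),
        0 < η ∧ e.IsSoleEnd ∧ e.R < Rstar ∧ ContDiff ℝ ∞ m ∧ SmoothSectionsOn 𝓘(ℝ, ℝ) G {p : ℝ × X | Rstar < p.1} ∧
        ∀ R : ℝ, Rstar < R → G R ∈ admissibleVacuumData X ∧ (∀ x ∉ e.far R, AgreeAt (G R) d x) ∧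
          η * R ≤ m R ∧ IsExactSchwarzschildBeyond e (G R) (m R) (32 * R) := by
  intro X _ _ _ _ _ _ d hd
  obtain ⟨e, M, I₀, hsole, hDR, hvac, hread⟩ := stub_endChartDatum X d hd
  obtain ⟨η, δ₀, hη, hδ₀, hunit⟩ := landed_unitAnnulusGluing_of_gluingFamily hG hSD hSO landed_chargeBound
  obtain ⟨Rstar, I, heR, h1, hIs, hIvac, hIread, hIsmall⟩ :=
    stub_endRescaling_of_chartDatum X d e M I₀ hDR hvac hread δ₀ hδ₀
  obtain ⟨O, hOs, hO⟩ := hunit Rstar I hIs hIvac hIsmall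
  obtain ⟨m, G, hm, hGs, hG'⟩ :=
    stub_farGluing_of_unitGluing X d e Rstar η I O hd hsole heR h1 hη hIread hOs hO
  exact ⟨η, e, Rstar, m, G, hη, hsole, heR, hm, hGs, hG'⟩

/-- **STUB (A) `stub_farGluing`** of the landed reduction — now a THEOREM modulo the atom. [cite: MaoOhTao2023, Thm 1.7, 1.10] -/
theorem stub_farGluing : ∀ (X : Type) [TopologicalSpace X] [ChartedSpace E3 X] [IsManifold (𝓡 3) ∞ X] [T2Space X]
      [SecondCountableTopology X] [ConnectedSpace X], ∀ d ∈ admissibleVacuumData X,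
      ∃ (η : ℝ) (e : AFEnd X) (Rstar : ℝ) (m : ℝ → ℝ) (G : ℝ → InitialDataSet (𝓡 3) X),
        0 < η ∧ e.IsSoleEnd ∧ e.R < Rstar ∧ ContDiff ℝ ∞ m ∧ SmoothSectionsOn 𝓘(ℝ, ℝ) G {p : ℝ × X | Rstar < p.1} ∧
        ∀ R : ℝ, Rstar < R → G R ∈ admissibleVacuumData X ∧ (∀ x ∉ e.far R, AgreeAt (G R) d x) ∧
          η * R ≤ m R ∧ IsExactSchwarzschildBeyond e (G R) (m R) (32 * R) :=
  farGluing_of_gluingFamily stub_gluingFamily stub_modelData.2 stub_schwOutSite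

/-- PlugData⁺ at every compactness bound from the `M`-exported form (take `M := 1`). [folklore] -/
theorem plugDataPlusAt_of_from
    (h : ∀ μ₀ : ℝ, 0 < μ₀ → ∀ M : ℝ, 0 < M →
      ∃ (μ ρ₃ lam : ℝ) (D₀ : InitialDataSet (𝓡 3) E3),
        0 < μ ∧ μ ≤ μ₀ ∧ 0 < ρ₃ ∧ ρ₃ < M / 40 ∧ 0 < lam ∧ 2 * lam < ρ₃ ∧
        (∀ [D₀.metric.HasLeviCivita], D₀.IsVacuumConstraintSolution) ∧
        (∀ y : E3, ρ₃ < ‖y‖ →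
          (∀ v w : E3, D₀.h.inner y v w = Schwarzschild.conformalFactor M y ^ 4 * ⟪v, w⟫_ℝ) ∧ D₀.k y = 0) ∧
        (∀ y : E3, lam < ‖y‖ → ‖y‖ < 2 * lam →
          (∀ v w : E3, D₀.h.inner y v w = (lam ^ 2)⁻¹ * (1 + lam * μ / (2 * ‖y‖)) ^ 4 * ⟪v, w⟫_ℝ) ∧
            D₀.k y = 0)) :
    ∀ μ₀ : ℝ, 0 < μ₀ → PlugDataPlusAt μ₀ := by
  intro μ₀ hμ₀
  obtain ⟨μ, ρ₃, lam, D₀, hμ, hμle, hρ₃, hρ₃M, hlam, hlam2, hvac, hext, hann⟩ := h μ₀ hμ₀ 1 one_pos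
  exact ⟨μ, 1, ρ₃, lam, D₀, hμ, hμle, one_pos, hρ₃, hρ₃M, hlam, hlam2, hvac, hext, hann⟩

/-- **STUB S5 `stub_collar_of_plugDataPlus`** (gen-1's registered statement) — a THEOREM from S5a and S5b. [folklore] -/
theorem stub_collar_of_plugDataPlus : (∀ μ₀ : ℝ, 0 < μ₀ → PlugDataPlusAt μ₀) →
    (∀ [Kerr.Facts], ∀ μ₀ : ℝ, 0 < μ₀ → ∃ μ : ℝ, 0 < μ ∧ μ ≤ μ₀ ∧
      ∃ C ∈ admissibleVacuumData E3, IsSchwarzschildAnnulus C μ ∧ IsKerrShieldedAway 2 C) :=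
  stub_collar_of_locatedPlug stub_locatedPlug

/-- **(B) the universal collar** `stub_collarDatum` of the landed reduction, from the atom (through the printed fact), the cap,
the model data, the Schwarzschild out-site, the corrected bulk and the collar plumbing. [cite: MaoOhTao2023, Thm 1.7] -/
theorem collarDatum_of_stubs :
    ∀ [Kerr.Facts], ∀ μ₀ : ℝ, 0 < μ₀ → ∃ μ : ℝ, 0 < μ ∧ μ ≤ μ₀ ∧
      ∃ C ∈ admissibleVacuumData E3, IsSchwarzschildAnnulus C μ ∧ IsKerrShieldedAway 2 C :=
  stub_collar_of_plugDataPlus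
    (plugDataPlusAt_of_from
      (stub_plugDataPlusFrom_of (obstructionFreeAnnularGluing_of_gluingFamily stub_gluingFamily) stub_capEnd
        stub_modelData.1 stub_modelData.2 stub_schwOutSite stub_bulkAt))

/-- **THE SKELETON THEOREM (v7).** The crux `SwallowTheDatum.ParametricKerrBurial` BY NAME, via the landed reduction
`ParametricKerrBurial_of_farGluing_of_collarDatum` (p92199); sorry-free itself, sorries only in `stub_*`.
[cite: MaoOhTao2023, Thm 1.7] -/
theorem ParametricKerrBurial_proof :
    Summit.FinalStateConjecture.FinalStateConjecture.Theses.SwallowTheDatum.ParametricKerrBurial :=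
  ParametricKerrBurial_of_farGluing_of_collarDatum stub_farGluing collarDatum_of_stubs

end Summit.FinalStateConjecture.FinalStateConjecture.Theorems.SwallowTheDatum.ParametricKerrBurial

end
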